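import Summits.QuantumFields.YangMills.Theorems.BalabanLadderUVSeamRecBoxThermalExcess
import Summits.QuantumFields.YangMills.Theorems.BalabanLadderUVSeamRecClassicalResponseDefs
import Summits.QuantumFields.YangMills.Theorems.SubOnsetCeilings.Negative.CubeKernelLaplace
import HarnessLib

/-!
# Crux `UVSeamRec` (stmt-QuantumFields-20043), line «coldwall_pure»: the BOX-SUMMED cold-wall-referenced classical split —
# `kerE^η_{β,Λ}(S_Λ) − kerE^{𝟙}_{β,Λ}(S_Λ) = m₀(η) ± #P_Λ (38 + 12 log β)/β` for every exterior and every cube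

Helper file (`--supports stmt-QuantumFields-20043`) of the LEAD seat `ym-spine-20043-p1` (gen 11): the corollary of `…BoxThermalExcess` (any exterior) and
`…ColdWallBoxCeiling` (identity exterior) in the letters of the line's classical objects (`ClassicalResponse.tiltedMin … 0 η` = the classical Dirichlet
energy `m₀(η)` of the cube with exterior `η`, gen 8 `…ClassicalResponseDefs`).

* **`kerE_wilsonBoundaryAction_mem_Icc`** — for `SU(2)`, every cube `(c, b)`, every exterior `η`, `β ≥ 1`:
  `m₀(η) ≤ kerE^η_{β,(c,b)}(S_Λ) ≤ m₀(η) + #P_Λ (38 + 12 log β)/β` — the mean box energy under any exterior is its classical Dirichlet minimum up to a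
  thermal `O(log β/β)` per plaquette, uniformly in the exterior and the cube;
* **`box_coldWallSplit`** — `kerE^η(S_Λ) − kerE^{𝟙}(S_Λ) ∈ [m₀(η) − #P_Λ(34 + 6 log β)/β, m₀(η) + #P_Λ(38 + 12 log β)/β]`: the box-summed «quantum
  response to the exterior, relative to the cold wall = classical Dirichlet energy ± thermal» — a rung under the line's `stub_coldWallSplit` (whose content
  is the same comparison at the CENTRE plaquette with tolerance `A₂C₁/R⁴` and the classical RESPONSE `carrierCl` in place of `m₀`).

HONEST FRAMING: elementary one-box Laplace bounds; nothing of E0′, NT or the gap; not Clay.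
-/

open MeasureTheory Finset
open Literature.MathematicalPhysics.QuantumFieldTheory (LatticeRep)
open Literature.MathematicalPhysics.QuantumLattice (fundamentalLatticeRep fundamentalRep LGConfig ZdEdge plaquettesTouching wilsonBoundaryAction
  isProbabilityMeasure_ymSpecification)
open Literature.Probability.LatticeModels (glueWith)
open Summit.QuantumFields.YangMills.Cruxes.OSLegsFromFemtoAndGap.DlrCollarTransfer
open Summit.QuantumFields.YangMills.Cruxes.UVSeamRec.ClassicalResponse (tiltedMin tiltedAction tiltedMin_le exists_tiltedMin_eq tiltedAction_zero)
open Summit.QuantumFields.YangMills.Theorems.SubOnsetCeilings.Negative (wilsonBoundaryAction_nonneg)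

noncomputable section

namespace Summit.QuantumFields.YangMills.Cruxes.UVSeamRec.ClassicalResponse.ThermalFloor

/-- **Mean box energy = classical Dirichlet minimum + thermal `O(#P log β/β)`** (`SU(2)`, every cube, every exterior, `β ≥ 1`):
`m₀(η) ≤ kerE^η_{β,(c,b)}(S_Λ) ≤ m₀(η) + #P_Λ (38 + 12 log β)/β`, `m₀(η) = tiltedMin … 0 η`. [folklore] -/
theorem kerE_wilsonBoundaryAction_mem_Icc (c : Fin 4 → ℤ) (b : ℕ) (q : Fin 4 × Fin 4) (x : Fin 4 → ℤ)
    (η : LGConfig 4 (Matrix.specialUnitaryGroup (Fin 2) ℂ)) {β : ℝ} (hβ : 1 ≤ β) :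
    kerE (Matrix.specialUnitaryGroup (Fin 2) ℂ) (fundamentalLatticeRep 2) β c b η
        (wilsonBoundaryAction (fundamentalRep (Fin 2)) (cubeEdges c b)) ∈
      Set.Icc (tiltedMin (fundamentalLatticeRep 2) c b q x 0 η)
        (tiltedMin (fundamentalLatticeRep 2) c b q x 0 η + (plaquettesTouching (cubeEdges c b)).card * ((38 + 12 * Real.log β) / β)) := by
  obtain ⟨ζ₀, hζ₀⟩ := exists_tiltedMin_eq (r := fundamentalLatticeRep 2) c b q x 0 η
  have hmin : ∀ ζ, wilsonBoundaryAction (fundamentalRep (Fin 2)) (cubeEdges c b) (glueWith (cubeEdges c b) ζ₀ η) ≤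
      wilsonBoundaryAction (fundamentalRep (Fin 2)) (cubeEdges c b) (glueWith (cubeEdges c b) ζ η) := by
    intro ζ
    have h := tiltedMin_le (r := fundamentalLatticeRep 2) c b q x 0 η ζ
    rw [← hζ₀, tiltedAction_zero, tiltedAction_zero] at h
    exact h
  have hm : tiltedMin (fundamentalLatticeRep 2) c b q x 0 η =
      wilsonBoundaryAction (fundamentalRep (Fin 2)) (cubeEdges c b) (glueWith (cubeEdges c b) ζ₀ η) := by
    rw [← hζ₀, tiltedAction_zero]; rfl
  rw [hm]
  exact ⟨le_kerE_wilsonBoundaryAction_of_isMin c b η hmin β, kerE_wilsonBoundaryAction_le_of_competitor c b η ζ₀ hβ⟩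

/-- **THE BOX-SUMMED COLD-WALL-REFERENCED CLASSICAL SPLIT** (`SU(2)`, every cube `(c, b)`, every exterior `η`, `β ≥ 1`):
`kerE^η_{β,(c,b)}(S_Λ) − kerE^{𝟙}_{β,(c,b)}(S_Λ) ∈ [m₀(η) − #P_Λ(34 + 6 log β)/β, m₀(η) + #P_Λ(38 + 12 log β)/β]` — the box-summed quantum response to the
exterior, measured against the cold wall, is the classical Dirichlet energy `m₀(η)` up to a thermal `O(log β/β)` per plaquette (`kerE^{𝟙}(S_Λ) ∈
[0, #P_Λ(34 + 6 log β)/β]` by `kerE_one_wilsonBoundaryAction_le_card_mul` and `S_Λ ≥ 0`). [folklore] -/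
theorem box_coldWallSplit (c : Fin 4 → ℤ) (b : ℕ) (q : Fin 4 × Fin 4) (x : Fin 4 → ℤ)
    (η : LGConfig 4 (Matrix.specialUnitaryGroup (Fin 2) ℂ)) {β : ℝ} (hβ : 1 ≤ β) :
    kerE (Matrix.specialUnitaryGroup (Fin 2) ℂ) (fundamentalLatticeRep 2) β c b η
        (wilsonBoundaryAction (fundamentalRep (Fin 2)) (cubeEdges c b)) -
      kerE (Matrix.specialUnitaryGroup (Fin 2) ℂ) (fundamentalLatticeRep 2) β c b (fun _ => 1)
        (wilsonBoundaryAction (fundamentalRep (Fin 2)) (cubeEdges c b)) ∈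
      Set.Icc (tiltedMin (fundamentalLatticeRep 2) c b q x 0 η - (plaquettesTouching (cubeEdges c b)).card * ((34 + 6 * Real.log β) / β))
        (tiltedMin (fundamentalLatticeRep 2) c b q x 0 η + (plaquettesTouching (cubeEdges c b)).card * ((38 + 12 * Real.log β) / β)) := by
  have h1 := kerE_wilsonBoundaryAction_mem_Icc c b q x η hβ
  have h2 := kerE_one_wilsonBoundaryAction_le_card_mul c b hβ
  have h3 : 0 ≤ kerE (Matrix.specialUnitaryGroup (Fin 2) ℂ) (fundamentalLatticeRep 2) β c b (fun _ => 1)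
      (wilsonBoundaryAction (fundamentalRep (Fin 2)) (cubeEdges c b)) := by
    unfold kerE
    exact integral_nonneg fun U => wilsonBoundaryAction_nonneg (fundamentalLatticeRep 2) (cubeEdges c b) U
  exact ⟨by linarith [h1.1], by linarith [h1.2]⟩

end Summit.QuantumFields.YangMills.Cruxes.UVSeamRec.ClassicalResponse.ThermalFloor

end
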